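import Summits.QuantumFields.YangMills.Theorems.BalabanUVNodesPortS1G3CTwinObjects
import Summits.QuantumFields.YangMills.Theorems.BalabanUVNodesPortS1LZdetTwinLocal

/-!
# NODE O port PT-A, offer (ζ) for `stub_G3C` of 27930 — THE INTEGER TWIN OF THE WALK PIECES IS WINDOW-LOCAL AND `SL(2,ℂ)`-INVARIANT: `g3cWZ F Mc TZY x` satisfies the first two
# clauses of row (gZ) from the P0-ℂ body's (Z-loc) and (Z-cov)

Cell `ym-nodeO-ideate`, porter seat `ymgap-nodeO-port-PTA-1` (gen 8), on ★★★ director-ym №573 (2); `--supports stmt-QuantumFields-27930` (helper, P0-free).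
[I] = [Balaban1987RG1], [B9] = [Balaban1985BackgroundPropagators], [16] = [Balaban1985UV3].

* §1 congruence: every integer walk object on `X̂` reads the configuration only through the piece matrices `TZ_Ŷ`, `Ŷ ⊆ X̂` (`g3cLocOpZ_congr`, `g3cLocInvZ_congr`, `g3cStepMZ_congr`,
  `g3cWalkTermZ_congr`, `g3cWmZ_congr`, `g3cWZ_congr`); ★ `isLocal_g3cWZ` — (Z-loc) + ✓`intSites_mono`.
* §2 block-diagonal conjugation `D(û) = ⊕_b̂ AdZ û b̂` ((Z-cov), ✓`twinMat_intGaugeAct`): it commutes with the cube-diagonal projections `P_Ẑ`, `𝟙_□̂` (`blockDiagonal_mul_diagonal_snd`), passes to the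
  cube-restricted block and its inverse (`submatrix_blockDiagonal_mul`, `submatrix_mul_blockDiagonal`, `g3cLocInvZ_conj`), hence conjugates every step matrix and leaves every walk term invariant
  (`g3cStepMZ_conj`, `listProd_conj`, `g3cWalkTermZ_conj`); ★ `isGaugeInv_g3cWZ`.

HONEST FRAMING.  Algebra over DISPLAYED clauses of the P0-ℂ body (inhabited nowhere); NOTHING of Bałaban's estimates asserted, ported or discharged; the third clause of (gZ) (the off-wrap bridge to
`g3cEG`) is the companion file `…G3CTwinBridge`; `stub_G3C` OPEN; 27930 OPEN · no claim; NODE O 0∕1; COUNT 8∕28 · K 1∕4 UNMOVED; finite `𝕋⁴_{L^K}` at fixed ε — NOT continuum ∕ OS ∕ Clay;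
**the Yang–Mills mass gap is NOT proved by any of this.**  No `sorry`, no `instance`, no `notation`; standard axioms.
-/

noncomputable section

open scoped BigOperators
open Finset

namespace Summit.QuantumFields.YangMills.Theorems.BalabanUVNodesPortS1

open Summit.QuantumFields.YangMills.Theorems.K0RecordFormatNames
open Literature.MathematicalPhysics.QuantumFieldTheory.Balaban1983to89
open Literature.MathematicalPhysics.QuantumFieldTheory.Balaban1983to89.Node00
open Literature.MathematicalPhysics.QuantumFieldTheory.Balaban1983to89.T4Continuum (T4Family)
open Literature.MathematicalPhysics.QuantumFieldTheory.Balaban1983to89.B14.Eq213MaximalDomains (cubeExt)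

variable (F : T4Family)
variable (Mc : ℕ) (TZY : Finset (Fin 4 → ℤ) → IntBondCfg → ((Fin 4 → ℤ) × Fin 4) × Fin 3 → ((Fin 4 → ℤ) × Fin 4) × Fin 3 → ℂ)

/-! ## §1  Congruence in the piece matrices; window-locality -/

section Congr

variable {Xh : Finset (Fin 4 → ℤ)} {f f' : IntBondCfg}

/-- `T^{(Ẑ)}` reads only the pieces `Ŷ ⊆ Ẑ`. [cite: Balaban1987RG1, (1.7) p.261] -/
theorem g3cLocOpZ_congr {Zh : Finset (Fin 4 → ℤ)} (h : ∀ Yh, Yh ⊆ Zh → twinMat F Mc TZY Xh Yh f = twinMat F Mc TZY Xh Yh f') :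
    g3cLocOpZ F Mc TZY Xh Zh f = g3cLocOpZ F Mc TZY Xh Zh f' := by
  unfold g3cLocOpZ
  exact Finset.sum_congr rfl fun Yh hYh => h Yh (Finset.mem_powerset.1 hYh)

/-- `G_Ẑ` reads only the pieces `Ŷ ⊆ Ẑ`. [cite: Balaban1985BackgroundPropagators, (3.87) p.409] -/
theorem g3cLocInvZ_congr {Zh : Finset (Fin 4 → ℤ)} (x : ℝ) (h : ∀ Yh, Yh ⊆ Zh → twinMat F Mc TZY Xh Yh f = twinMat F Mc TZY Xh Yh f') :
    g3cLocInvZ F Mc TZY Xh Zh x f = g3cLocInvZ F Mc TZY Xh Zh x f' := by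
  have hB : g3cLocBlockZ F Mc TZY Xh Zh x f = g3cLocBlockZ F Mc TZY Xh Zh x f' := by
    unfold g3cLocBlockZ; rw [g3cLocOpZ_congr F Mc TZY h]
  ext i j
  unfold g3cLocInvZ
  rw [hB]

/-- `S^M_{□̂,Ŷ}` reads only `TZ_Ŷ` and the pieces inside `□̃`. [cite: Balaban1985BackgroundPropagators, (3.88) p.409] -/
theorem g3cStepMZ_congr (x : ℝ) {s : (Fin 4 → ℤ) × Finset (Fin 4 → ℤ)} (h : ∀ Yh, Yh ⊆ g3cBlkZ s.1 → twinMat F Mc TZY Xh Yh f = twinMat F Mc TZY Xh Yh f')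
    (h2 : twinMat F Mc TZY Xh s.2 f = twinMat F Mc TZY Xh s.2 f') :
    g3cStepMZ F Mc TZY Xh x f s = g3cStepMZ F Mc TZY Xh x f' s := by
  unfold g3cStepMZ g3cStepZ
  rw [h2, g3cLocInvZ_congr F Mc TZY x h]

/-- A walk term reads only the pieces inside its localization. [cite: Balaban1987RG1, (1.7) p.261; Balaban1985BackgroundPropagators, (3.90) p.409] -/
theorem g3cWalkTermZ_congr (x : ℝ) {q₀ : Fin 4 → ℤ} {m : ℕ} {w : Fin m → (Fin 4 → ℤ) × Finset (Fin 4 → ℤ)}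
    (h : ∀ Yh, Yh ⊆ g3cWalkLocZ q₀ w → twinMat F Mc TZY Xh Yh f = twinMat F Mc TZY Xh Yh f') :
    g3cWalkTermZ F Mc TZY Xh x f q₀ w = g3cWalkTermZ F Mc TZY Xh x f' q₀ w := by
  obtain ⟨h0, hs⟩ := subset_of_g3cWalkLocZ_eq (rfl : g3cWalkLocZ q₀ w = g3cWalkLocZ q₀ w)
  have hS : (fun i => g3cStepMZ F Mc TZY Xh x f (w i)) = fun i => g3cStepMZ F Mc TZY Xh x f' (w i) :=
    funext fun i => g3cStepMZ_congr F Mc TZY x (fun Yh hYh => h Yh (hYh.trans (hs i).2)) (h _ (hs i).1)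
  unfold g3cWalkTermZ
  rw [g3cLocInvZ_congr F Mc TZY x fun Yh hYh => h Yh (hYh.trans h0), hS]

/-- `Ŵ_m(X̂)` reads only the pieces `Ŷ ⊆ X̂`. [cite: Balaban1987RG1, (1.7) p.261, (1.21) p.264] -/
theorem g3cWmZ_congr (x : ℝ) (m : ℕ) (h : ∀ Yh, Yh ⊆ Xh → twinMat F Mc TZY Xh Yh f = twinMat F Mc TZY Xh Yh f') :
    g3cWmZ F Mc TZY x m Xh f = g3cWmZ F Mc TZY x m Xh f' := by
  unfold g3cWmZ
  refine Finset.sum_congr rfl fun q₀ _ => Finset.sum_congr rfl fun w _ => ?_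
  split_ifs with hloc
  · exact g3cWalkTermZ_congr F Mc TZY x fun Yh hYh => h Yh (hYh.trans hloc.le)
  · rfl

/-- `Ŵ(X̂)` reads only the pieces `Ŷ ⊆ X̂`. [cite: Balaban1987RG1, (1.21) p.264] -/
theorem g3cWZ_congr (x : ℝ) (h : ∀ Yh, Yh ⊆ Xh → twinMat F Mc TZY Xh Yh f = twinMat F Mc TZY Xh Yh f') :
    g3cWZ F Mc TZY x Xh f = g3cWZ F Mc TZY x Xh f' := by
  unfold g3cWZ
  exact tsum_congr fun m => by rw [g3cWmZ_congr F Mc TZY x m h]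

end Congr

/-- ★ **`g3cWZ` IS WINDOW-LOCAL at side `L^{k+1}·Mc`** ((Z-loc) entry by entry on the pieces `Ŷ ⊆ X̂`, whose windows are sub-windows). [cite: Balaban1987RG1, (1.7) p.261, (1.21) p.264] -/
theorem isLocal_g3cWZ (k : ℕ) (x : ℝ) (hZloc : ∀ i j : ((Fin 4 → ℤ) × Fin 4) × Fin 3, IntFormula.IsLocal (F.L ^ (k + 1) * Mc) fun Xh f => TZY Xh f i j) :
    IntFormula.IsLocal (F.L ^ (k + 1) * Mc) (g3cWZ F Mc TZY x) := by
  intro Xh f f' hff'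
  refine g3cWZ_congr F Mc TZY x fun Yh hYh => ?_
  ext i j
  simp only [twinMat, Matrix.of_apply]
  exact hZloc _ _ Yh f f' fun zμ h1 h2 => hff' zμ (intSites_mono _ hYh h1) (intSites_mono _ hYh h2)

/-! ## §2  Block-diagonal conjugation; `SL(2,ℂ)`-invariance -/

section Conj

variable {ι o : Type*} [Fintype ι] [Fintype o] [DecidableEq o]

/-- A block-diagonal matrix commutes with a diagonal matrix that is constant on the blocks. [folklore] -/
theorem blockDiagonal_mul_diagonal_snd [DecidableEq ι] (M : o → Matrix ι ι ℂ) (c : o → ℂ) :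
    Matrix.blockDiagonal M * Matrix.diagonal (fun i : ι × o => c i.2) = Matrix.diagonal (fun i : ι × o => c i.2) * Matrix.blockDiagonal M := by
  ext i j
  rw [Matrix.mul_diagonal, Matrix.diagonal_mul, Matrix.blockDiagonal_apply]
  split_ifs with h
  · rw [h, mul_comm]
  · rw [zero_mul, mul_zero]

/-- A finite sum whose terms vanish off `P` is the sum over the subtype of `P`. [folklore] -/
theorem sum_eq_sum_subtype_of_zero {T : Type*} [Fintype T] (P : T → Prop) [DecidablePred P] (g : T → ℂ) (hg : ∀ t, ¬ P t → g t = 0) :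
    ∑ t, g t = ∑ t : {t // P t}, g t.1 := by
  rw [← Fintype.sum_subtype_add_sum_subtype P g, Finset.sum_eq_zero (fun (t : {t // ¬ P t}) _ => hg t.1 t.2), add_zero]

/-- Restriction to a union of blocks is multiplicative against a block-diagonal LEFT factor. [folklore] -/
theorem submatrix_blockDiagonal_mul (M : o → Matrix ι ι ℂ) (P : ι × o → Prop) [DecidablePred P] (hP : ∀ i j : ι × o, i.2 = j.2 → (P i ↔ P j))
    (A : Matrix (ι × o) (ι × o) ℂ) :
    (Matrix.blockDiagonal M * A).submatrix (Subtype.val : {i // P i} → ι × o) (Subtype.val : {i // P i} → ι × o) =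
      (Matrix.blockDiagonal M).submatrix (Subtype.val : {i // P i} → ι × o) (Subtype.val : {i // P i} → ι × o) *
        A.submatrix (Subtype.val : {i // P i} → ι × o) (Subtype.val : {i // P i} → ι × o) := by
  ext i j
  simp only [Matrix.submatrix_apply, Matrix.mul_apply]
  refine sum_eq_sum_subtype_of_zero P (fun l => Matrix.blockDiagonal M i.1 l * A l j.1) fun l hl => ?_
  rw [Matrix.blockDiagonal_apply]
  split_ifs with h
  · exact absurd ((hP _ _ h).1 i.2) hl
  · exact zero_mul _

/-- Restriction to a union of blocks is multiplicative against a block-diagonal RIGHT factor. [folklore] -/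
theorem submatrix_mul_blockDiagonal (M : o → Matrix ι ι ℂ) (P : ι × o → Prop) [DecidablePred P] (hP : ∀ i j : ι × o, i.2 = j.2 → (P i ↔ P j))
    (A : Matrix (ι × o) (ι × o) ℂ) :
    (A * Matrix.blockDiagonal M).submatrix (Subtype.val : {i // P i} → ι × o) (Subtype.val : {i // P i} → ι × o) =
      A.submatrix (Subtype.val : {i // P i} → ι × o) (Subtype.val : {i // P i} → ι × o) *
        (Matrix.blockDiagonal M).submatrix (Subtype.val : {i // P i} → ι × o) (Subtype.val : {i // P i} → ι × o) := by
  ext i j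
  simp only [Matrix.submatrix_apply, Matrix.mul_apply]
  refine sum_eq_sum_subtype_of_zero P (fun l => A i.1 l * Matrix.blockDiagonal M l j.1) fun l hl => ?_
  rw [Matrix.blockDiagonal_apply]
  split_ifs with h
  · exact absurd ((hP _ _ h).2 j.2) hl
  · exact mul_zero _

/-- Conjugation of a list product: `Π (D·S_i·D′) = D·(Π S_i)·D′` when `D′D = 1 = DD′`. [folklore] -/
theorem listProd_conj {n : Type*} [Fintype n] [DecidableEq n] {D D' : Matrix n n ℂ} (hDD' : D * D' = 1) (hD'D : D' * D = 1) :
    ∀ l : List (Matrix n n ℂ), (l.map fun S => D * S * D').prod = D * l.prod * D'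
  | [] => by simp [hDD']
  | S :: l => by
      rw [List.map_cons, List.prod_cons, List.prod_cons, listProd_conj hDD' hD'D l]
      calc D * S * D' * (D * l.prod * D') = D * S * (D' * D) * l.prod * D' := by simp only [Matrix.mul_assoc]
        _ = D * (S * l.prod) * D' := by rw [hD'D, Matrix.mul_one, Matrix.mul_assoc D S]

end Conj

section Gauge

variable {Xh : Finset (Fin 4 → ℤ)}
variable (AdZ : ((Fin 4 → ℤ) → (MatA 2)ˣ) → (Fin 4 → ℤ) × Fin 4 → Matrix (Fin 3) (Fin 3) ℂ) (û : (Fin 4 → ℤ) → (MatA 2)ˣ)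

/-- The conjugating block-diagonal `D(û) = ⊕_b̂ AdZ û b̂` on the integer index of `X̂` (named to state the lemmas below). [cite: Balaban1987RG1, (1.10) p.262, (1.19) p.263] -/
def twinD (Xh : Finset (Fin 4 → ℤ)) : Matrix (TwinIdx F Mc Xh) (TwinIdx F Mc Xh) ℂ :=
  Matrix.blockDiagonal fun b : ↥(twinBonds F Mc Xh) => AdZ û b.1

/-- Its blockwise inverse `D′(û) = ⊕_b̂ (AdZ û b̂)⁻¹`. [cite: Balaban1987RG1, (1.10) p.262, (1.19) p.263] -/
def twinD' (Xh : Finset (Fin 4 → ℤ)) : Matrix (TwinIdx F Mc Xh) (TwinIdx F Mc Xh) ℂ :=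
  Matrix.blockDiagonal fun b : ↥(twinBonds F Mc Xh) => (AdZ û b.1)⁻¹

variable {F Mc TZY AdZ û}

/-- `D·D′ = 1` for invertible blocks. [folklore] -/
theorem twinD_mul_twinD' (hunit : ∀ b : (Fin 4 → ℤ) × Fin 4, IsUnit (AdZ û b)) : twinD F Mc AdZ û Xh * twinD' F Mc AdZ û Xh = 1 := by
  unfold twinD twinD'
  rw [← Matrix.blockDiagonal_mul]
  have : (fun b : ↥(twinBonds F Mc Xh) => AdZ û b.1 * (AdZ û b.1)⁻¹) = fun _ => 1 :=
    funext fun b => Matrix.mul_nonsing_inv _ ((Matrix.isUnit_iff_isUnit_det _).1 (hunit b.1))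
  rw [this]; exact Matrix.blockDiagonal_one

/-- `D′·D = 1` for invertible blocks. [folklore] -/
theorem twinD'_mul_twinD (hunit : ∀ b : (Fin 4 → ℤ) × Fin 4, IsUnit (AdZ û b)) : twinD' F Mc AdZ û Xh * twinD F Mc AdZ û Xh = 1 := by
  unfold twinD twinD'
  rw [← Matrix.blockDiagonal_mul]
  have : (fun b : ↥(twinBonds F Mc Xh) => (AdZ û b.1)⁻¹ * AdZ û b.1) = fun _ => 1 :=
    funext fun b => Matrix.nonsing_inv_mul _ ((Matrix.isUnit_iff_isUnit_det _).1 (hunit b.1))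
  rw [this]; exact Matrix.blockDiagonal_one

/-- Entries of `D` off the bond-diagonal vanish. [folklore] -/
theorem twinD_apply_of_ne {i j : TwinIdx F Mc Xh} (h : i.2 ≠ j.2) : twinD F Mc AdZ û Xh i j = 0 := by
  unfold twinD; rw [Matrix.blockDiagonal_apply, if_neg h]

/-- Entries of `D′` off the bond-diagonal vanish. [folklore] -/
theorem twinD'_apply_of_ne {i j : TwinIdx F Mc Xh} (h : i.2 ≠ j.2) : twinD' F Mc AdZ û Xh i j = 0 := by
  unfold twinD'; rw [Matrix.blockDiagonal_apply, if_neg h]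

/-- The cube of an integer index depends only on its bond. [cite: Balaban1987RG1, (1.21) p.264 (bookkeeping)] -/
theorem twinCube_eq_of_snd_eq {i j : TwinIdx F Mc Xh} (h : i.2 = j.2) : twinCube F Mc i = twinCube F Mc j := by
  unfold twinCube; rw [h]

/-- `P_Ẑ` commutes with `D` and `D′` (it is constant on bonds). [cite: Balaban1985BackgroundPropagators, (3.87) p.409] -/
theorem g3cProjZ_comm_twinD (Zh : Finset (Fin 4 → ℤ)) :
    twinD F Mc AdZ û Xh * g3cProjZ F Mc Xh Zh = g3cProjZ F Mc Xh Zh * twinD F Mc AdZ û Xh ∧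
      twinD' F Mc AdZ û Xh * g3cProjZ F Mc Xh Zh = g3cProjZ F Mc Xh Zh * twinD' F Mc AdZ û Xh :=
  ⟨blockDiagonal_mul_diagonal_snd _ (fun b : ↥(twinBonds F Mc Xh) =>
      if Literature.MathematicalPhysics.QuantumLattice.blockMap (F.L * Mc) b.1.1 ∈ Zh then (1 : ℂ) else 0),
    blockDiagonal_mul_diagonal_snd _ (fun b : ↥(twinBonds F Mc Xh) =>
      if Literature.MathematicalPhysics.QuantumLattice.blockMap (F.L * Mc) b.1.1 ∈ Zh then (1 : ℂ) else 0)⟩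

/-- `𝟙_□̂` commutes with `D` and `D′`. [cite: Balaban1985BackgroundPropagators, (3.87) p.409] -/
theorem g3cIndZ_comm_twinD (q : Fin 4 → ℤ) :
    twinD F Mc AdZ û Xh * g3cIndZ F Mc Xh q = g3cIndZ F Mc Xh q * twinD F Mc AdZ û Xh ∧
      twinD' F Mc AdZ û Xh * g3cIndZ F Mc Xh q = g3cIndZ F Mc Xh q * twinD' F Mc AdZ û Xh :=
  ⟨blockDiagonal_mul_diagonal_snd _ (fun b : ↥(twinBonds F Mc Xh) =>
      (((if Literature.MathematicalPhysics.QuantumLattice.blockMap (F.L * Mc) b.1.1 = q then (1 : ℝ) else 0) : ℝ) : ℂ)),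
    blockDiagonal_mul_diagonal_snd _ (fun b : ↥(twinBonds F Mc Xh) =>
      (((if Literature.MathematicalPhysics.QuantumLattice.blockMap (F.L * Mc) b.1.1 = q then (1 : ℝ) else 0) : ℝ) : ℂ))⟩

/-- **`T^{(Ẑ)}` is conjugated** when every piece is. [cite: Balaban1987RG1, (1.19) p.263] -/
theorem g3cLocOpZ_conj {f f' : IntBondCfg} (Zh : Finset (Fin 4 → ℤ))
    (hT : ∀ Yh, twinMat F Mc TZY Xh Yh f' = twinD F Mc AdZ û Xh * twinMat F Mc TZY Xh Yh f * twinD' F Mc AdZ û Xh) :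
    g3cLocOpZ F Mc TZY Xh Zh f' = twinD F Mc AdZ û Xh * g3cLocOpZ F Mc TZY Xh Zh f * twinD' F Mc AdZ û Xh := by
  unfold g3cLocOpZ
  rw [Finset.mul_sum, Finset.sum_mul]
  exact Finset.sum_congr rfl fun Yh _ => hT Yh

/-- The restricted `D`, `D′` are mutually inverse. [folklore] -/
theorem twinD_sub_mul_twinD'_sub (Zh : Finset (Fin 4 → ℤ)) (hunit : ∀ b : (Fin 4 → ℤ) × Fin 4, IsUnit (AdZ û b)) :
    (twinD F Mc AdZ û Xh).submatrix (Subtype.val : {i : TwinIdx F Mc Xh // twinCube F Mc i ∈ Zh} → TwinIdx F Mc Xh)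
        (Subtype.val : {i : TwinIdx F Mc Xh // twinCube F Mc i ∈ Zh} → TwinIdx F Mc Xh) *
      (twinD' F Mc AdZ û Xh).submatrix (Subtype.val : {i : TwinIdx F Mc Xh // twinCube F Mc i ∈ Zh} → TwinIdx F Mc Xh)
        (Subtype.val : {i : TwinIdx F Mc Xh // twinCube F Mc i ∈ Zh} → TwinIdx F Mc Xh) = 1 ∧
    (twinD' F Mc AdZ û Xh).submatrix (Subtype.val : {i : TwinIdx F Mc Xh // twinCube F Mc i ∈ Zh} → TwinIdx F Mc Xh)
        (Subtype.val : {i : TwinIdx F Mc Xh // twinCube F Mc i ∈ Zh} → TwinIdx F Mc Xh) *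
      (twinD F Mc AdZ û Xh).submatrix (Subtype.val : {i : TwinIdx F Mc Xh // twinCube F Mc i ∈ Zh} → TwinIdx F Mc Xh)
        (Subtype.val : {i : TwinIdx F Mc Xh // twinCube F Mc i ∈ Zh} → TwinIdx F Mc Xh) = 1 := by
  have hP : ∀ i j : TwinIdx F Mc Xh, i.2 = j.2 → (twinCube F Mc i ∈ Zh ↔ twinCube F Mc j ∈ Zh) := fun i j h => by rw [twinCube_eq_of_snd_eq h]
  constructor
  · have h := submatrix_blockDiagonal_mul (fun b : ↥(twinBonds F Mc Xh) => AdZ û b.1) (fun i : TwinIdx F Mc Xh => twinCube F Mc i ∈ Zh) hP (twinD' F Mc AdZ û Xh)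
    rw [← twinD, twinD_mul_twinD' hunit, Matrix.submatrix_one _ Subtype.val_injective] at h
    exact h.symm
  · have h := submatrix_blockDiagonal_mul (fun b : ↥(twinBonds F Mc Xh) => (AdZ û b.1)⁻¹) (fun i : TwinIdx F Mc Xh => twinCube F Mc i ∈ Zh) hP (twinD F Mc AdZ û Xh)
    rw [← twinD', twinD'_mul_twinD hunit, Matrix.submatrix_one _ Subtype.val_injective] at h
    exact h.symm

/-- **The restricted block is conjugated by the restricted `D`** (the restriction is to a union of bond blocks). [cite: Balaban1985UV3, p.272; Balaban1987RG1, (1.19) p.263] -/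
theorem g3cLocBlockZ_conj {f f' : IntBondCfg} (Zh : Finset (Fin 4 → ℤ)) (x : ℝ) (hunit : ∀ b : (Fin 4 → ℤ) × Fin 4, IsUnit (AdZ û b))
    (hT : ∀ Yh, twinMat F Mc TZY Xh Yh f' = twinD F Mc AdZ û Xh * twinMat F Mc TZY Xh Yh f * twinD' F Mc AdZ û Xh) :
    g3cLocBlockZ F Mc TZY Xh Zh x f' =
      (twinD F Mc AdZ û Xh).submatrix (Subtype.val : {i : TwinIdx F Mc Xh // twinCube F Mc i ∈ Zh} → TwinIdx F Mc Xh)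
          (Subtype.val : {i : TwinIdx F Mc Xh // twinCube F Mc i ∈ Zh} → TwinIdx F Mc Xh) *
        g3cLocBlockZ F Mc TZY Xh Zh x f *
        (twinD' F Mc AdZ û Xh).submatrix (Subtype.val : {i : TwinIdx F Mc Xh // twinCube F Mc i ∈ Zh} → TwinIdx F Mc Xh)
          (Subtype.val : {i : TwinIdx F Mc Xh // twinCube F Mc i ∈ Zh} → TwinIdx F Mc Xh) := by
  have hP : ∀ i j : TwinIdx F Mc Xh, i.2 = j.2 → (twinCube F Mc i ∈ Zh ↔ twinCube F Mc j ∈ Zh) := fun i j h => by rw [twinCube_eq_of_snd_eq h]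
  have h1 := submatrix_blockDiagonal_mul (fun b : ↥(twinBonds F Mc Xh) => AdZ û b.1) (fun i : TwinIdx F Mc Xh => twinCube F Mc i ∈ Zh) hP
    (g3cLocOpZ F Mc TZY Xh Zh f * twinD' F Mc AdZ û Xh)
  have h2 := submatrix_mul_blockDiagonal (fun b : ↥(twinBonds F Mc Xh) => (AdZ û b.1)⁻¹) (fun i : TwinIdx F Mc Xh => twinCube F Mc i ∈ Zh) hP
    (g3cLocOpZ F Mc TZY Xh Zh f)
  rw [← twinD] at h1
  rw [← twinD'] at h2
  unfold g3cLocBlockZ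
  rw [g3cLocOpZ_conj Zh hT, Matrix.mul_assoc (twinD F Mc AdZ û Xh), h1, h2, Matrix.mul_add, Matrix.add_mul, Matrix.mul_smul, Matrix.mul_one, Matrix.smul_mul,
    (twinD_sub_mul_twinD'_sub (F := F) (Mc := Mc) (Xh := Xh) Zh hunit).1, Matrix.mul_assoc]

/-- **The integer local inverse is conjugated**: `G_Ẑ(x, û·f) = D · G_Ẑ(x, f) · D′` (inverse of the conjugated restricted block; the extension by zero is to a union of bond blocks).
[cite: Balaban1985BackgroundPropagators, (3.87) p.409; Balaban1985UV3, (63) p.272] -/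
theorem g3cLocInvZ_conj {f f' : IntBondCfg} (Zh : Finset (Fin 4 → ℤ)) (x : ℝ) (hunit : ∀ b : (Fin 4 → ℤ) × Fin 4, IsUnit (AdZ û b))
    (hT : ∀ Yh, twinMat F Mc TZY Xh Yh f' = twinD F Mc AdZ û Xh * twinMat F Mc TZY Xh Yh f * twinD' F Mc AdZ û Xh) :
    g3cLocInvZ F Mc TZY Xh Zh x f' = twinD F Mc AdZ û Xh * g3cLocInvZ F Mc TZY Xh Zh x f * twinD' F Mc AdZ û Xh := by
  obtain ⟨hs1, hs2⟩ := twinD_sub_mul_twinD'_sub (F := F) (Mc := Mc) (Xh := Xh) Zh hunit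
  have hinv : (g3cLocBlockZ F Mc TZY Xh Zh x f')⁻¹ =
      (twinD F Mc AdZ û Xh).submatrix (Subtype.val : {i : TwinIdx F Mc Xh // twinCube F Mc i ∈ Zh} → TwinIdx F Mc Xh) Subtype.val *
        (g3cLocBlockZ F Mc TZY Xh Zh x f)⁻¹ *
        (twinD' F Mc AdZ û Xh).submatrix (Subtype.val : {i : TwinIdx F Mc Xh // twinCube F Mc i ∈ Zh} → TwinIdx F Mc Xh) Subtype.val := by
    rw [g3cLocBlockZ_conj Zh x hunit hT, Matrix.mul_inv_rev, Matrix.mul_inv_rev, Matrix.inv_eq_right_inv hs2, Matrix.inv_eq_right_inv hs1, Matrix.mul_assoc]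
  ext i j
  simp only [Matrix.mul_apply]
  by_cases hi : twinCube F Mc i ∈ Zh
  · by_cases hj : twinCube F Mc j ∈ Zh
    · rw [g3cLocInvZ_apply_of_mem F Mc TZY Xh Zh x f' hi hj, hinv]
      simp only [Matrix.mul_apply, Matrix.submatrix_apply]
      rw [sum_eq_sum_subtype_of_zero (fun l' : TwinIdx F Mc Xh => twinCube F Mc l' ∈ Zh)
        (fun l' => (∑ l, twinD F Mc AdZ û Xh i l * g3cLocInvZ F Mc TZY Xh Zh x f l l') * twinD' F Mc AdZ û Xh l' j) fun l' hl' => by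
          rw [Finset.sum_eq_zero fun l _ => by rw [g3cLocInvZ_apply_of_not_mem F Mc TZY Xh Zh x f (Or.inr hl'), mul_zero], zero_mul]]
      refine Finset.sum_congr rfl fun l' _ => ?_
      rw [sum_eq_sum_subtype_of_zero (fun l : TwinIdx F Mc Xh => twinCube F Mc l ∈ Zh)
        (fun l => twinD F Mc AdZ û Xh i l * g3cLocInvZ F Mc TZY Xh Zh x f l l') fun l hl => by
          rw [g3cLocInvZ_apply_of_not_mem F Mc TZY Xh Zh x f (Or.inl hl), mul_zero]]
      congr 1
      refine Finset.sum_congr rfl fun l _ => ?_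
      rw [g3cLocInvZ_apply_of_mem F Mc TZY Xh Zh x f l.2 l'.2]
    · rw [g3cLocInvZ_apply_of_not_mem F Mc TZY Xh Zh x f' (Or.inr hj)]
      symm
      refine Finset.sum_eq_zero fun l' _ => ?_
      by_cases hl' : l'.2 = j.2
      · rw [Finset.sum_eq_zero fun l _ => by
          rw [g3cLocInvZ_apply_of_not_mem F Mc TZY Xh Zh x f (Or.inr (by rwa [twinCube_eq_of_snd_eq hl'])), mul_zero], zero_mul]
      · rw [twinD'_apply_of_ne hl', mul_zero]
  · rw [g3cLocInvZ_apply_of_not_mem F Mc TZY Xh Zh x f' (Or.inl hi)]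
    symm
    refine Finset.sum_eq_zero fun l' _ => ?_
    rw [Finset.sum_eq_zero fun l _ => ?_, zero_mul]
    by_cases hl : i.2 = l.2
    · rw [g3cLocInvZ_apply_of_not_mem F Mc TZY Xh Zh x f (Or.inl (by rwa [← twinCube_eq_of_snd_eq hl])), mul_zero]
    · rw [twinD_apply_of_ne hl, zero_mul]

/-- **Every admissible step matrix is conjugated**: `S^M_{□̂,Ŷ}(û·f) = D · S^M_{□̂,Ŷ}(f) · D′`. [cite: Balaban1985BackgroundPropagators, (3.88) p.409; Balaban1987RG1, (1.19) p.263] -/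
theorem g3cStepMZ_conj {f f' : IntBondCfg} (x : ℝ) (hunit : ∀ b : (Fin 4 → ℤ) × Fin 4, IsUnit (AdZ û b))
    (hT : ∀ Yh, twinMat F Mc TZY Xh Yh f' = twinD F Mc AdZ û Xh * twinMat F Mc TZY Xh Yh f * twinD' F Mc AdZ û Xh)
    (s : (Fin 4 → ℤ) × Finset (Fin 4 → ℤ)) :
    g3cStepMZ F Mc TZY Xh x f' s = twinD F Mc AdZ û Xh * g3cStepMZ F Mc TZY Xh x f s * twinD' F Mc AdZ û Xh := by
  unfold g3cStepMZ
  split_ifs with h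
  · rw [Matrix.mul_zero, Matrix.zero_mul]
  · unfold g3cStepZ
    set D := twinD F Mc AdZ û Xh with hD
    set D' := twinD' F Mc AdZ û Xh with hD'
    have hP2 : D' * g3cProjZ F Mc Xh (g3cBlkZ s.1) = g3cProjZ F Mc Xh (g3cBlkZ s.1) * D' := (g3cProjZ_comm_twinD (AdZ := AdZ) (û := û) (g3cBlkZ s.1)).2
    have hI2 : D' * g3cIndZ F Mc Xh s.1 = g3cIndZ F Mc Xh s.1 * D' := (g3cIndZ_comm_twinD (AdZ := AdZ) (û := û) s.1).2
    have hD'D : D' * D = 1 := twinD'_mul_twinD hunit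
    rw [hT s.2, g3cLocInvZ_conj (g3cBlkZ s.1) x hunit hT]
    calc D * twinMat F Mc TZY Xh s.2 f * D' * g3cProjZ F Mc Xh (g3cBlkZ s.1) * (D * g3cLocInvZ F Mc TZY Xh (g3cBlkZ s.1) x f * D') * g3cIndZ F Mc Xh s.1
        = D * twinMat F Mc TZY Xh s.2 f * (D' * g3cProjZ F Mc Xh (g3cBlkZ s.1)) * D * g3cLocInvZ F Mc TZY Xh (g3cBlkZ s.1) x f * (D' * g3cIndZ F Mc Xh s.1) := by
          simp only [Matrix.mul_assoc]
      _ = D * twinMat F Mc TZY Xh s.2 f * (g3cProjZ F Mc Xh (g3cBlkZ s.1) * D') * D * g3cLocInvZ F Mc TZY Xh (g3cBlkZ s.1) x f * (g3cIndZ F Mc Xh s.1 * D') := by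
          rw [hP2, hI2]
      _ = D * twinMat F Mc TZY Xh s.2 f * g3cProjZ F Mc Xh (g3cBlkZ s.1) * (D' * D) * g3cLocInvZ F Mc TZY Xh (g3cBlkZ s.1) x f * g3cIndZ F Mc Xh s.1 * D' := by
          simp only [Matrix.mul_assoc]
      _ = D * (twinMat F Mc TZY Xh s.2 f * g3cProjZ F Mc Xh (g3cBlkZ s.1) * g3cLocInvZ F Mc TZY Xh (g3cBlkZ s.1) x f * g3cIndZ F Mc Xh s.1) * D' := by
          rw [hD'D, Matrix.mul_one]; simp only [Matrix.mul_assoc]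

/-- **Every walk term is invariant**: `t(□̂₀, ŵ)(û·f) = t(□̂₀, ŵ)(f)` (all factors conjugated by `D`, the cube-diagonal `𝟙_{□̂₀}` commutes with `D′`, and the trace is cyclic).
[cite: Balaban1985BackgroundPropagators, (3.90) p.409; Balaban1985UV3, (63) p.272; Balaban1987RG1, (1.19) p.263] -/
theorem g3cWalkTermZ_conj {f f' : IntBondCfg} (x : ℝ) (hunit : ∀ b : (Fin 4 → ℤ) × Fin 4, IsUnit (AdZ û b))
    (hT : ∀ Yh, twinMat F Mc TZY Xh Yh f' = twinD F Mc AdZ û Xh * twinMat F Mc TZY Xh Yh f * twinD' F Mc AdZ û Xh)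
    (q₀ : Fin 4 → ℤ) {m : ℕ} (w : Fin m → (Fin 4 → ℤ) × Finset (Fin 4 → ℤ)) :
    g3cWalkTermZ F Mc TZY Xh x f' q₀ w = g3cWalkTermZ F Mc TZY Xh x f q₀ w := by
  set D := twinD F Mc AdZ û Xh with hD
  set D' := twinD' F Mc AdZ û Xh with hD'
  have hDD' : D * D' = 1 := twinD_mul_twinD' hunit
  have hD'D : D' * D = 1 := twinD'_mul_twinD hunit
  have hI2 : D' * g3cIndZ F Mc Xh q₀ = g3cIndZ F Mc Xh q₀ * D' := (g3cIndZ_comm_twinD (AdZ := AdZ) (û := û) q₀).2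
  have hS : (List.ofFn fun i => g3cStepMZ F Mc TZY Xh x f' (w i)) = (List.ofFn fun i => g3cStepMZ F Mc TZY Xh x f (w i)).map fun S => D * S * D' := by
    rw [← List.ofFn_comp']
    exact congrArg List.ofFn (funext fun i => g3cStepMZ_conj x hunit hT (w i))
  unfold g3cWalkTermZ
  rw [hS, listProd_conj hDD' hD'D, g3cLocInvZ_conj (g3cBlkZ q₀) x hunit hT]
  calc (D * g3cLocInvZ F Mc TZY Xh (g3cBlkZ q₀) x f * D' * g3cIndZ F Mc Xh q₀ *
          (D * (List.ofFn fun i => g3cStepMZ F Mc TZY Xh x f (w i)).prod * D')).trace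
      = (D * g3cLocInvZ F Mc TZY Xh (g3cBlkZ q₀) x f * (D' * g3cIndZ F Mc Xh q₀) * D *
          (List.ofFn fun i => g3cStepMZ F Mc TZY Xh x f (w i)).prod * D').trace := by simp only [Matrix.mul_assoc]
    _ = (D * g3cLocInvZ F Mc TZY Xh (g3cBlkZ q₀) x f * g3cIndZ F Mc Xh q₀ * (D' * D) *
          (List.ofFn fun i => g3cStepMZ F Mc TZY Xh x f (w i)).prod * D').trace := by rw [hI2]; simp only [Matrix.mul_assoc]
    _ = (D * (g3cLocInvZ F Mc TZY Xh (g3cBlkZ q₀) x f * g3cIndZ F Mc Xh q₀ * (List.ofFn fun i => g3cStepMZ F Mc TZY Xh x f (w i)).prod) * D').trace := by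
          rw [hD'D, Matrix.mul_one]; simp only [Matrix.mul_assoc]
    _ = (g3cLocInvZ F Mc TZY Xh (g3cBlkZ q₀) x f * g3cIndZ F Mc Xh q₀ * (List.ofFn fun i => g3cStepMZ F Mc TZY Xh x f (w i)).prod).trace := by
          rw [Matrix.trace_mul_comm, ← Matrix.mul_assoc, hD'D, Matrix.one_mul]

/-- **`Ŵ_m` is invariant.** [cite: Balaban1985BackgroundPropagators, (3.90) p.409; Balaban1987RG1, (1.19) p.263] -/
theorem g3cWmZ_conj {f f' : IntBondCfg} (x : ℝ) (hunit : ∀ b : (Fin 4 → ℤ) × Fin 4, IsUnit (AdZ û b))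
    (hT : ∀ Yh, twinMat F Mc TZY Xh Yh f' = twinD F Mc AdZ û Xh * twinMat F Mc TZY Xh Yh f * twinD' F Mc AdZ û Xh) (m : ℕ) :
    g3cWmZ F Mc TZY x m Xh f' = g3cWmZ F Mc TZY x m Xh f := by
  unfold g3cWmZ
  refine Finset.sum_congr rfl fun q₀ _ => Finset.sum_congr rfl fun w _ => ?_
  split_ifs
  · exact g3cWalkTermZ_conj x hunit hT q₀ w
  · rfl

end Gauge

/-- ★ **`g3cWZ` IS `SL(2,ℂ)`-INVARIANT**: under (Z-cov) (blockwise covariance of the integer pieces through invertible `AdZ û b̂`), the integer twin of the walk pieces is invariant under the pulled-back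
(1.10) action of every `SL(2,ℂ)`-valued `û`. [cite: Balaban1987RG1, (1.19) p.263, (1.10) p.262; Balaban1985UV3, (63) p.272; Balaban1985BackgroundPropagators, (3.90) p.409] -/
theorem isGaugeInv_g3cWZ (AdZ : ((Fin 4 → ℤ) → (MatA 2)ˣ) → (Fin 4 → ℤ) × Fin 4 → Matrix (Fin 3) (Fin 3) ℂ) (x : ℝ)
    (hZcov : ∀ û : (Fin 4 → ℤ) → (MatA 2)ˣ, (∀ z, û z ∈ (B12RegularSpaces111SpecialUnitary.suModel 2).Gc) →
      (∀ b : (Fin 4 → ℤ) × Fin 4, IsUnit (AdZ û b)) ∧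
      ∀ (Xh : Finset (Fin 4 → ℤ)) (f : IntBondCfg) (bi bj : (Fin 4 → ℤ) × Fin 4),
        (Matrix.of fun a a' : Fin 3 => TZY Xh (intGaugeAct û f) (bi, a) (bj, a')) =
          AdZ û bi * (Matrix.of fun a a' : Fin 3 => TZY Xh f (bi, a) (bj, a')) * (AdZ û bj)⁻¹) :
    IntFormula.IsGaugeInv (g3cWZ F Mc TZY x) := by
  intro Xh û hû f
  obtain ⟨hunit, hcov⟩ := hZcov û hû
  show g3cWZ F Mc TZY x Xh (intGaugeAct û f) = g3cWZ F Mc TZY x Xh f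
  have hT : ∀ Yh, twinMat F Mc TZY Xh Yh (intGaugeAct û f) = twinD F Mc AdZ û Xh * twinMat F Mc TZY Xh Yh f * twinD' F Mc AdZ û Xh :=
    fun Yh => twinMat_intGaugeAct F Mc TZY AdZ û hcov Xh Yh f
  unfold g3cWZ
  exact tsum_congr fun m => by rw [g3cWmZ_conj x hunit hT m]

end Summit.QuantumFields.YangMills.Theorems.BalabanUVNodesPortS1

end
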